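import Mathlib
import Summits.ValiantsHypothesis.ValiantsHypothesis.Theses.GirthSidon
import Summits.ValiantsHypothesis.ValiantsHypothesis.Theorems.GirthSidonShortEvenCycleMoore

/-!
# Route GirthSidon — `ShortEvenCycle` (weak Bondy–Simonovits even-cycle bound)

Closes support item stmt-ValiantsHypothesis-6540 of route `GirthSidon`:

`ShortEvenCycle : ∀ k N, 1 ≤ k → 1 ≤ N → ∀ G : SimpleGraph (Fin N),
  4 ^ k * N ^ (k + 1) ≤ |E(G)| ^ k → ∃ u (p : G.Walk u u), p.IsCycle ∧ Even p.length ∧ p.length ≤ 2k`,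

i.e. `e ≥ 4 N^{1 + 1/k}` edges force an even cycle of length at most `2k`.

Proof (the classical Moore-bound argument; the three graph-theoretic engines live in
`GirthSidonShortEvenCycleMoore.lean`).  Suppose `G` has no even cycle of length `≤ 2k`.
1. *Max cut* (`exists_coloring_card_edgeFinset_le_two_mul`): a `2`-colouring `c` whose
   bichromatic subgraph `Hc = G.between {c = true} {c = true}ᶜ` keeps `e₁ ≥ e/2` edges; every
   closed walk of `Hc` is even, so `Hc` has no cycle of length `≤ 2k` at all.
2. *Threshold*: `t :=` the least natural with `N ≤ t^k`; from `4^k N^{k+1} ≤ e^k ≤ 2^k e₁^k` one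
   gets `t·N < e₁` (`mul_lt_of_two_pow_mul_pow_le`).
3. *Core* (`exists_core_of_lt_sum_card_neighborFinset_inter` with the handshake lemma): a
   nonempty vertex set `S` inside which every vertex has `≥ t + 1` neighbours; restrict `Hc` to
   `S` (`H' = Hc.between S S`).
4. *Even Moore bound* (`moore_layer_bound` in `H'`, `δ = t + 1`, radius `k`): the distance-`k`
   sphere around a vertex of `S` has `≥ (t+1) t^{k-1} = t^k + t^{k-1} > N` vertices — absurd.
For `k = 1` the hypothesis `4 N² ≤ e` is impossible, consistently with there being no `2`-cycles;
the argument above covers it uniformly.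

Sources: Bondy–Simonovits (1974) prove the much stronger `ex(n, C_{2k}) = O(n^{1+1/k})`; only
this weak form (an even cycle of length *at most* `2k`, constant `4`) is used by the route
(items ToricSwallowForcesShortRelation, SparseSwallowForcesShortRelation with `k = 30`).
-/

namespace Summit.ValiantsHypothesis.ValiantsHypothesis.Theorems

-- `Summit.ValiantsHypothesis.ValiantsHypothesis.…` is the tree's mandated single-conjunct layout (Sub = Summit).
set_option linter.dupNamespace false

open Finset
open Summit.ValiantsHypothesis.ValiantsHypothesis.Theorems.ShortEvenCycle

/-- Arithmetic for the final count: if `2^k · N^(k+1) ≤ e^k` (`k, N ≥ 1`) and `t` is least with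
`N ≤ t^k`, then `t · N < e`.  (Otherwise `2^k N ≤ t^k`, while minimality gives
`(2(t-1))^k < 2^k N`, forcing `t = 1` and `2^k N ≤ 1`.) [folklore] -/
theorem ShortEvenCycle.mul_lt_of_two_pow_mul_pow_le {k N t e : ℕ} (hk : 1 ≤ k) (hN : 1 ≤ N)
    (ht : N ≤ t ^ k) (hmin : ∀ t' < t, t' ^ k < N) (he : 2 ^ k * N ^ (k + 1) ≤ e ^ k) :
    t * N < e := by
  by_contra hle
  push Not at hle
  have h1 : e ^ k ≤ t ^ k * N ^ k := by
    rw [← mul_pow]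
    exact Nat.pow_le_pow_left hle k
  have h2 : 2 ^ k * N ≤ t ^ k := by
    have : 2 ^ k * N * N ^ k ≤ t ^ k * N ^ k := by
      calc 2 ^ k * N * N ^ k = 2 ^ k * N ^ (k + 1) := by ring
        _ ≤ e ^ k := he
        _ ≤ t ^ k * N ^ k := h1
    exact Nat.le_of_mul_le_mul_right this (by positivity)
  have ht1 : 1 ≤ t := by
    rcases Nat.eq_zero_or_pos t with rfl | h
    · rw [zero_pow (by omega)] at ht
      omega
    · exact h
  have h3 : (t - 1) ^ k < N := hmin (t - 1) (by omega)
  have h4 : (2 * (t - 1)) ^ k < t ^ k := by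
    calc (2 * (t - 1)) ^ k = 2 ^ k * (t - 1) ^ k := by rw [mul_pow]
      _ < 2 ^ k * N := Nat.mul_lt_mul_of_pos_left h3 (by positivity)
      _ ≤ t ^ k := h2
  have h5 : 2 * (t - 1) < t := lt_of_pow_lt_pow_left₀ k (by positivity) h4
  have h6 : t = 1 := by omega
  subst h6
  rw [one_pow] at h2
  have h7 : 1 < 2 ^ k := Nat.one_lt_two_pow_iff.2 (by omega)
  have h8 : 2 ^ k ≤ 2 ^ k * N := Nat.le_mul_of_pos_right _ (by omega)
  omega

/-- **`ShortEvenCycle` (route GirthSidon, item stmt-ValiantsHypothesis-6540).** A simple graph on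
`N ≥ 1` vertices with `e` edges and `4^k N^{k+1} ≤ e^k` (`k ≥ 1`) contains a cycle of even
length at most `2k`.  Weak form of Bondy–Simonovits 1974 (even girth / Moore bound): max cut,
min-degree core, BFS layer growth — see the module docstring. [folklore] -/
theorem shortEvenCycle_proof :
    Summit.ValiantsHypothesis.ValiantsHypothesis.Theses.GirthSidon.ShortEvenCycle := by
  unfold Summit.ValiantsHypothesis.ValiantsHypothesis.Theses.GirthSidon.ShortEvenCycle
  intro k N hk hN G hE
  classical
  by_contra hno
  push Not at hno
  -- edge count as a finset cardinality
  have hEcard : G.edgeSet.ncard = #G.edgeFinset := by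
    rw [← SimpleGraph.coe_edgeFinset, Set.ncard_coe_finset]
  rw [hEcard] at hE
  -- Step 1: a bipartite subgraph `Hc` with at least half of the edges
  obtain ⟨c, hc⟩ := exists_coloring_card_edgeFinset_le_two_mul G
  set Hc := G.between {v | c v = true} {v | c v = true}ᶜ with hHc
  have hHcG : Hc ≤ G := SimpleGraph.between_le
  have hcut : ∀ x y, Hc.Adj x y → c x ≠ c y := by
    intro x y h
    have h2 := h.2
    simp only [Set.mem_setOf_eq, Set.mem_compl_iff] at h2
    cases hx : c x <;> cases hy : c y <;> simp_all
  -- Step 2: the threshold `t` = least `t` with `N ≤ t ^ k`; then `t · N < |E(Hc)|`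
  have hex : ∃ t, N ≤ t ^ k := ⟨N, Nat.le_self_pow (by omega) N⟩
  obtain ⟨ht, hmin⟩ : N ≤ Nat.find hex ^ k ∧ ∀ t' < Nat.find hex, t' ^ k < N :=
    ⟨Nat.find_spec hex, fun t' h => lt_of_not_ge (Nat.find_min hex h)⟩
  set t := Nat.find hex with htdef
  have he₁ : 2 ^ k * N ^ (k + 1) ≤ #Hc.edgeFinset ^ k := by
    have h1 : 4 ^ k * N ^ (k + 1) ≤ (2 * #Hc.edgeFinset) ^ k :=
      hE.trans (Nat.pow_le_pow_left hc k)
    have h4 : (4 : ℕ) ^ k = 2 ^ k * 2 ^ k := by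
      rw [← mul_pow]
      norm_num
    rw [mul_pow, h4, mul_assoc] at h1
    exact Nat.le_of_mul_le_mul_left h1 (by positivity)
  have htN : t * N < #Hc.edgeFinset :=
    ShortEvenCycle.mul_lt_of_two_pow_mul_pow_le hk hN ht hmin he₁
  -- Step 3: a core `S` with all degrees into `S` at least `t + 1`
  have hsum : 2 * t * #(univ : Finset (Fin N)) < ∑ x ∈ univ, #(Hc.neighborFinset x ∩ univ) := by
    simp only [inter_univ, card_univ, Fintype.card_fin, SimpleGraph.card_neighborFinset_eq_degree]
    rw [SimpleGraph.sum_degrees_eq_twice_card_edges]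
    calc 2 * t * N = 2 * (t * N) := by ring
      _ < 2 * #Hc.edgeFinset := by omega
  obtain ⟨S, -, hSne, hSdeg⟩ := exists_core_of_lt_sum_card_neighborFinset_inter Hc t univ hsum
  -- Step 4: restrict `Hc` to the core
  set H' := Hc.between (S : Set (Fin N)) (S : Set (Fin N)) with hH'
  have hH'Hc : H' ≤ Hc := SimpleGraph.between_le
  have hH'G : H' ≤ G := hH'Hc.trans hHcG
  have hadj' : ∀ x y, H'.Adj x y ↔ Hc.Adj x y ∧ x ∈ S ∧ y ∈ S := by
    intro x y
    rw [hH', SimpleGraph.between_adj]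
    simp only [Finset.mem_coe, or_self]
  -- closed walks in `H'` are even (2-colouring), and `H'` has no cycle of length `≤ 2k`
  let col : H'.Coloring Bool := SimpleGraph.Coloring.mk c fun h => hcut _ _ (hH'Hc h)
  have hEven' : ∀ (u : Fin N) (p : H'.Walk u u), Even p.length := fun u p =>
    (col.even_length_iff_congr p).2 Iff.rfl
  have hGirth' : ∀ (u : Fin N) (p : H'.Walk u u), p.IsCycle → 2 * k < p.length := by
    intro u p hp
    have h1 : (p.mapLe hH'G).IsCycle := (SimpleGraph.Walk.isCycle_mapLe hH'G).2 hp
    have h2 := hno u (p.mapLe hH'G) h1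
    have h3 : (p.mapLe hH'G).length = p.length := SimpleGraph.Walk.length_map _ _
    rw [h3] at h2
    exact h2 (hEven' u p)
  -- degrees in `H'`
  have hnbr : ∀ w, H'.neighborFinset w = if w ∈ S then Hc.neighborFinset w ∩ S else ∅ := by
    intro w
    ext x
    by_cases hw : w ∈ S <;> simp [hadj', hw]
  have hδ' : ∀ w, 0 < H'.degree w → t + 1 ≤ H'.degree w := by
    intro w hw
    rw [← SimpleGraph.card_neighborFinset_eq_degree, hnbr] at hw ⊢
    by_cases hwS : w ∈ S
    · rw [if_pos hwS] at hw ⊢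
      exact hSdeg w hwS
    · rw [if_neg hwS] at hw
      simp at hw
  obtain ⟨v, hvS⟩ := hSne
  have hv : 0 < H'.degree v := by
    rw [← SimpleGraph.card_neighborFinset_eq_degree, hnbr, if_pos hvS]
    have := hSdeg v hvS
    omega
  -- Step 5: the even Moore bound at radius `k` contradicts `|V| = N ≤ t ^ k`
  have hM := moore_layer_bound H' hEven' hGirth' hδ' hv k hk le_rfl
  have hcard : #(univ.filter fun w => H'.dist v w = k) ≤ N :=
    (card_le_univ _).trans_eq (Fintype.card_fin N)
  have ht1 : 1 ≤ t := by
    rcases Nat.eq_zero_or_pos t with h | h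
    · rw [h, zero_pow (by omega)] at ht
      omega
    · exact h
  have hexp : (t + 1) * (t + 1 - 1) ^ (k - 1) = t ^ k + t ^ (k - 1) := by
    have h := pow_succ t (k - 1)
    rw [Nat.sub_add_cancel hk] at h
    rw [Nat.add_sub_cancel, h]
    ring
  have hpos : 1 ≤ t ^ (k - 1) := Nat.one_le_pow _ _ ht1
  rw [hexp] at hM
  omega

end Summit.ValiantsHypothesis.ValiantsHypothesis.Theorems
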